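import Summits.ResolutionOfSingularities.ResolutionOfSingularities.Theorems.FrobeniusClosingPatchingRelPerfectTwoPlanesExcCurveT
import Summits.ResolutionOfSingularities.ResolutionOfSingularities.Theorems.FrobeniusClosingPatchingRelPerfectTwoPlanesLevelTwoS
import Summits.ResolutionOfSingularities.ResolutionOfSingularities.Theorems.FrobeniusClosingPatchingRelPerfectJacobianCriterion
import HarnessLib

/-!
# Crux `PatchingRelPerfect` (stmt-ResolutionOfSingularities-16161), chain w52 — the rank-two member
# `f = x₀x₁ + x₂³`: the exceptional curve of the `s`-chart of `B₂` is a hyperbola (facts `hQr`, `hQ0`)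

[OURS · L1 W5.2 · rung, DESIGN STAGE → instance facts, piece P2 (i = 2) of NEXT-two-planes-cube.md Add. 6]
On `B₂` the two hypotheses of `…TwoPlanesLevelTwoS.isRegular_of_isBlowup_tpProd_s` about
`(B₂/(u,e₀))[S] ⧸ (S ē₁ + ē₂³)` are DISCHARGED: `ē₂ = 1` on `B₂`, and under the combined model
`(B₂/(u,e₀))[S] ≅ κ[S, T₁, T₃]` (`…TwoPlanesExcCurveT.exists_planeModelEquiv`, `mapEquiv`, `sumAlgEquiv`)
the equation becomes the HYPERBOLA `X_S X_{T₁} + 1`, regular by the Jacobian criterion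
(`…JacobianCriterion`: `∂_S = X_{T₁}`, `∂_{T₁} = X_S` do not both vanish on it) and non-zero.

* `isRegularRing_quot_span_X_mul_X_add_one`, `X_mul_X_add_one_ne_zero` — the hyperbola, any base;
* `exists_excCurveS_model` — `S ē₁ + ē₂³ ↦ X_S X_{T₁} + 1`;
* `excCurveS_isRegularRing_two` (`hQr`), `excCurveS_ne_zero_two` (`hQ0`).

On `B₃` the analogous quotient is the `A₂` surface `S T₁ + T₂³` (NOT regular): that chart needs further
centres (design open).  Nothing here is a statement of the manuscript under review.

## References

* The Stacks Project, Tag 0BIQ. [StacksProject]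
* H. Matsumura, *Commutative Ring Theory*, CUP 1986, Thm. 14.2. [Matsumura1987]
-/

-- `Summit.<Summit>.<Sub>.Theorems` with `Sub = Summit` (single-conjunct summit, D-0017)
set_option linter.dupNamespace false

noncomputable section

open CategoryTheory CategoryTheory.Limits AlgebraicGeometry Literature.AlgebraicGeometry.Resolution
open IsLocalRing

namespace Summit.ResolutionOfSingularities.ResolutionOfSingularities.Theorems

namespace TwoPlanesRung

open ConeRung

universe u

section ExcCurveS

variable {S : Type u} [CommRing S] [IsRegularLocalRing S] (x : Fin 4 → S)
  (hx : Ideal.span (Set.range x) = IsLocalRing.maximalIdeal S)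
  (hd : (IsLocalRing.maximalIdeal S).spanFinrank = 4)

local notation3 "M" => Ideal.span (Set.range x)
local notation3 "B₂" => chartRing x 2
local notation3 "II₂" => Ideal.span (Set.range
  (Fin.cons (chartBase x 2 (x 2)) (fun _ : Fin 1 => chartGen x 2 0) : Fin 2 → chartRing x 2))
local notation3 "κ'" => S ⧸ (Ideal.span (Set.range x) ⊔ ⊥)
local notation3 "σ₂" => {j : Fin 4 // j ≠ (2 : Fin 4) ∧ j ∉ ({0} : Set (Fin 4))}
local notation3 "σ₀" => {j : Fin 2 // j ≠ 0}
local notation3 (prettyPrint := false) "PP₀" => MvPolynomial {j : Fin 2 // j ≠ 0} (chartRing x 2 ⧸ II₂)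
local notation3 (prettyPrint := false) "hFlat" =>
  MvPolynomial.X (⟨1, one_ne_zero_fin2⟩ : {j : Fin 2 // j ≠ 0}) *
    (MvPolynomial.C (Ideal.Quotient.mk II₂ (chartGen x 2 1)) : MvPolynomial {j : Fin 2 // j ≠ 0} (chartRing x 2 ⧸ II₂))
  + MvPolynomial.C (Ideal.Quotient.mk II₂ (chartGen x 2 2 ^ 3))
/-- the combined polynomial model `κ[S, T₁, T₃]` of `(B₂/(u,e₀))[S]` -/
local notation3 (prettyPrint := false) "R₀" => MvPolynomial ({j : Fin 2 // j ≠ 0} ⊕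
  {j : Fin 4 // j ≠ (2 : Fin 4) ∧ j ∉ ({0} : Set (Fin 4))}) (S ⧸ (Ideal.span (Set.range x) ⊔ ⊥))

omit [IsRegularLocalRing S] in
/-- `2 ≠ 0` and `2 ≠ 1` in `Fin 4`. [folklore] -/
theorem two_ne_zero_one_fin4 : (2 : Fin 4) ≠ 0 ∧ (2 : Fin 4) ≠ 1 := by decide

/-- **The hyperbola `X_a X_b + 1 = 0` is regular**: Jacobian criterion (`∂_a = X_b`, `∂_b = X_a`
cannot both vanish where `X_a X_b = -1`). [cite: Matsumura1987, Thm. 14.2] -/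
theorem isRegularRing_quot_span_X_mul_X_add_one {k : Type*} [CommRing k] [IsRegularRing k] {τ : Type*}
    [DecidableEq τ] [Finite τ] (a b : τ) (hab : a ≠ b) :
    IsRegularRing (MvPolynomial τ k ⧸
      Ideal.span {(MvPolynomial.X a * MvPolynomial.X b + 1 : MvPolynomial τ k)}) := by
  haveI : IsRegularRing (MvPolynomial τ k) := inferInstance
  refine MvPolynomial.isRegularRing_quotient_span_of_pderiv fun Q hQ hF => ?_
  by_contra hall
  have ha : MvPolynomial.pderiv a (MvPolynomial.X a * MvPolynomial.X b + 1 : MvPolynomial τ k) ∈ Q := by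
    by_contra h
    exact hall ⟨a, h⟩
  have hb : MvPolynomial.pderiv b (MvPolynomial.X a * MvPolynomial.X b + 1 : MvPolynomial τ k) ∈ Q := by
    by_contra h
    exact hall ⟨b, h⟩
  rw [map_add, MvPolynomial.pderiv_one, add_zero, MvPolynomial.pderiv_mul, MvPolynomial.pderiv_X_self,
    MvPolynomial.pderiv_X_of_ne hab.symm, mul_zero, add_zero, one_mul] at ha
  rw [map_add, MvPolynomial.pderiv_one, add_zero, MvPolynomial.pderiv_mul, MvPolynomial.pderiv_X_self,
    MvPolynomial.pderiv_X_of_ne hab, zero_mul, zero_add, mul_one] at hb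
  -- `X_b, X_a ∈ Q` ⇒ `1 = F - X_a X_b ∈ Q`
  have h1 : (1 : MvPolynomial τ k) ∈ Q := by
    have := Q.sub_mem hF (Q.mul_mem_left (MvPolynomial.X a) ha)
    rwa [add_sub_cancel_left] at this
  exact hQ.ne_top ((Ideal.eq_top_iff_one Q).mpr h1)

/-- The hyperbola equation is non-zero (its constant coefficient is `1`). [folklore] -/
theorem X_mul_X_add_one_ne_zero {k : Type*} [CommRing k] [Nontrivial k] {τ : Type*} (a b : τ) :
    (MvPolynomial.X a * MvPolynomial.X b + 1 : MvPolynomial τ k) ≠ 0 := by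
  intro h
  have h1 := congrArg MvPolynomial.constantCoeff h
  rw [map_add, map_mul, MvPolynomial.constantCoeff_X, zero_mul, zero_add, map_one, map_zero] at h1
  exact one_ne_zero h1

include hx hd in
/-- **The exceptional curve of the `s`-chart of `B₂` is a hyperbola**: there is an isomorphism
`(B₂/(u,e₀))[S] ≅ κ[S, T₁, T₃]` taking `S ē₁ + ē₂³ = S ē₁ + 1` to `X_S X_{T₁} + 1`.
[cite: StacksProject, Tag 0BIQ] -/
theorem exists_excCurveS_model :
    ∃ E : PP₀ ≃+* R₀, E hFlat =
      MvPolynomial.X (Sum.inl ⟨1, one_ne_zero_fin2⟩) *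
        MvPolynomial.X (Sum.inr ⟨1, two_ne_zero_one_fin4.2.symm, one_notMem_zero_set⟩) + 1 := by
  classical
  haveI : IsDomain κ' := isDomain_residue_sup_bot x hx
  obtain ⟨ε, hε⟩ := exists_planeModelEquiv x hx hd 2 two_ne_zero_one_fin4.1
  let E : PP₀ ≃+* R₀ :=
    (MvPolynomial.mapEquiv σ₀ ε).trans (MvPolynomial.sumAlgEquiv κ' σ₀ σ₂).symm.toRingEquiv
  have hEC : ∀ a : B₂ ⧸ II₂, E (MvPolynomial.C a) =
      (MvPolynomial.sumAlgEquiv κ' σ₀ σ₂).symm (MvPolynomial.C (ε a)) := fun a => by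
    change (MvPolynomial.sumAlgEquiv κ' σ₀ σ₂).symm (MvPolynomial.mapEquiv σ₀ ε (MvPolynomial.C a)) = _
    rw [MvPolynomial.mapEquiv_apply, MvPolynomial.map_C]
    rfl
  have hEX : E (MvPolynomial.X ⟨1, one_ne_zero_fin2⟩) = MvPolynomial.X (Sum.inl ⟨1, one_ne_zero_fin2⟩) := by
    change (MvPolynomial.sumAlgEquiv κ' σ₀ σ₂).symm
      (MvPolynomial.mapEquiv σ₀ ε (MvPolynomial.X ⟨1, one_ne_zero_fin2⟩)) = _
    rw [MvPolynomial.mapEquiv_apply, MvPolynomial.map_X, MvPolynomial.sumAlgEquiv_symm_X]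
  have h22 : chartGen x 2 2 = 1 := chartGen_self x 2
  have hz1 : Ideal.Quotient.mk II₂ (chartGen x 2 2 ^ 3) = 1 := by
    rw [h22]
    exact (map_pow _ _ _).trans ((congrArg (· ^ 3) (map_one _)).trans (one_pow 3))
  refine ⟨E, ?_⟩
  rw [map_add, map_mul, hz1, MvPolynomial.C_1, map_one, hEC, hEX,
    hε 1 two_ne_zero_one_fin4.2.symm one_notMem_zero_set, MvPolynomial.sumAlgEquiv_symm_C_X]

include hx hd in
/-- **The `s`-chart fact `hQr` of `…TwoPlanesLevelTwoS` holds on `B₂`** (the exceptional curve is a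
hyperbola). [cite: StacksProject, Tag 0BIQ] [cite: Matsumura1987, Thm. 14.2] -/
theorem excCurveS_isRegularRing_two : IsRegularRing (PP₀ ⧸ Ideal.span {hFlat}) := by
  classical
  haveI : IsDomain κ' := isDomain_residue_sup_bot x hx
  haveI : IsRegularRing κ' := isRegularRing_residue_sup_bot x hx
  obtain ⟨E, hE⟩ := exists_excCurveS_model x hx hd
  have hab : (Sum.inl ⟨1, one_ne_zero_fin2⟩ : σ₀ ⊕ σ₂) ≠
      Sum.inr ⟨1, two_ne_zero_one_fin4.2.symm, one_notMem_zero_set⟩ := Sum.inl_ne_inr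
  let F : R₀ := MvPolynomial.X (Sum.inl ⟨1, one_ne_zero_fin2⟩ : σ₀ ⊕ σ₂) *
    MvPolynomial.X (Sum.inr ⟨1, two_ne_zero_one_fin4.2.symm, one_notMem_zero_set⟩) + 1
  have hmap : Ideal.span {F} = (Ideal.span {hFlat}).map (E : PP₀ →+* R₀) := by
    rw [Ideal.map_span, Set.image_singleton]
    exact congrArg (fun t => Ideal.span {t}) hE.symm
  let EE := Ideal.quotientEquiv (Ideal.span {hFlat}) (Ideal.span {F}) E hmap
  haveI : IsRegularRing (R₀ ⧸ Ideal.span {F}) :=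
    isRegularRing_quot_span_X_mul_X_add_one (k := κ') _ _ hab
  exact IsRegularRing.of_ringEquiv (R := R₀ ⧸ Ideal.span {F}) EE.symm

include hx hd in
/-- **The `s`-chart fact `hQ0` of `…TwoPlanesLevelTwoS` holds on `B₂`**: `S ē₁ + ē₂³ ≠ 0`.
[cite: StacksProject, Tag 0BIQ] -/
theorem excCurveS_ne_zero_two : hFlat ≠ 0 := by
  classical
  haveI : IsDomain κ' := isDomain_residue_sup_bot x hx
  obtain ⟨E, hE⟩ := exists_excCurveS_model x hx hd
  intro h0
  have h1 : E hFlat = 0 := by rw [h0, map_zero]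
  rw [hE] at h1
  exact X_mul_X_add_one_ne_zero (k := κ') _ _ h1

end ExcCurveS

end TwoPlanesRung

end Summit.ResolutionOfSingularities.ResolutionOfSingularities.Theorems

end
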